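import Summits.AtomisticToContinuum.Crystallization.Theorems.ContactSaturationLadderAreaTop
import Literature.Geometry.DiscreteGeometry.SphereCoveringFejesToth

/-!
# ContactSaturationLadderCoveringRung — the FEJES TÓTH rung of the floor-7/10 tolerance ladder beneath the residual
# `NoLooseChunks` of crux `LooseTextureRung`, PROVED MODULO ONE CITED LITERATURE FACT (helper, supports item 30303;
# lens-1 g33 land twin of node §44 `CoveringRung44`, kernels only)

PREREQUISITES (land in this order): `Theorems/ContactSaturationLadderAreaTop.lean` (g33 twin #1: `angle_le_arccos_of_dist_lt_one`,
`ballCoveringBound_mono`) and the one-fact Literature file `Literature/Geometry/DiscreteGeometry/SphereCoveringFejesToth.lean`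
(`FejesToth1943_sphereCovering` + its cosine form `FejesToth1943_sphereCovering.cos_le`).

What is proved here (0 sorry):
* numerics at `ω₁₁ = 11π/54`: `cos_omega_eleven_le : cos (11π/54) ≤ 803/1000` (from `Real.sin_ge_sub_cube` at `11π/108` and
  `Real.pi_gt_d4 / pi_lt_d4`), `sin_omega_eleven_pos`, `cos_omega_eleven_nonneg`;
* `cover_family_of_finset`: a cover by the caps about `≤ n` centres re-indexed as a cover by an `n`-family (the typing of the fact);
* **★ `ballCoveringBound_eight_fifths_of_sphereCovering : FejesToth1943_sphereCovering → BallCoveringBound 11 (8/5)`** — eleven points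
  within `< 1` of every point of `S(c, 8/5)` would give eleven caps of angular radius `arccos (√39/8) = 38.68°` covering `S²`, against
  Fejes Tóth's `≥ arccos (cot ω₁₁/√3) = 39.15°` (`3·(39/64)·sin² ω₁₁ ≤ cos² ω₁₁ ⇒ cos² ω₁₁ ≥ 117/181`, contradicting `cos ω₁₁ ≤ 0.803`);
  `ballCoveringBound_of_sphereCovering : … → 8/5 ≤ ρ → BallCoveringBound 11 ρ`;
* **the rung** `noLooseChunksF_2p75_of_sphereCovering : FejesToth1943_sphereCovering → NoLooseChunksF (11/4)` (the tree's
  `noLooseChunksF_2p75_of_fejesToth` with its hypothesis derived from the cited theorem), `bandExclusionF_2p75_of_sphereCovering`, and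
  `noLooseChunksF_two_iff_band_of_sphereCovering : … → (NoLooseChunksF 2 ↔ BandExclusionF 2 (11/4))` — modulo the fact, the top piece
  of the ladder is BAND_F(2, 11/4).

No `def`, no `instance`, no `notation`, no `axiom`, no `sorry`.  Source: lens-1 g33 node `LooseTextureRung_node_g33.lean` §44.1–§44.4
verbatim (the node carries a definitionally-equal copy of the fact because the Literature file had not landed; the §44.5 compositions to
`LooseTextureRung` stay node-side).  Checked as `scratch44.lean` (the fact file and the two AreaTop lemmas inlined) — farm rc 0 · 0 warnings ·
0 sorry · axioms {propext, Classical.choice, Quot.sound}; re-check after the two prerequisites land.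
-/

noncomputable section

namespace Summit.AtomisticToContinuum.Crystallization.Theorems.ContactSaturationLadderCoveringRung

open scoped BigOperators Classical
open Metric Set
open Literature.Geometry.DiscreteGeometry (sphCap FejesToth1943_sphereCovering)
open Summit.AtomisticToContinuum.Crystallization.Theorems.ContactSaturationLadderToleranceFloor (NoLooseChunksF BandExclusionF
  bandExclusionF_of_noLooseChunksF noLooseChunksF_iff_band)
open Summit.AtomisticToContinuum.Crystallization.Theorems.ContactSaturationLadderGeometricTop (BallCoveringBound
  noLooseChunksF_2p75_of_fejesToth)
open Summit.AtomisticToContinuum.Crystallization.Theorems.ContactSaturationLadderAreaTop (angle_le_arccos_of_dist_lt_one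
  ballCoveringBound_mono)

/-! ### §44.1 Numerics at `ω₁₁ = 11π/54` (`= 36.67°`): `cos ω₁₁ ≤ 0.803`, `sin ω₁₁ > 0` -/

/-- `cos (11π/54) ≤ 803/1000` (true value `0.80212…`): `cos 2y = 1 − 2 sin² y` with `y = 11π/108 ∈ [0.3199, 0.32]`
and `sin y ≥ y − y³/6 ≥ 0.3139`. -/
theorem cos_omega_eleven_le : Real.cos (11 * Real.pi / 54) ≤ 803 / 1000 := by
  have hy : 11 * Real.pi / 54 = 2 * (11 * Real.pi / 108) := by ring
  rw [hy, Real.cos_two_mul]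
  set y : ℝ := 11 * Real.pi / 108 with hydef
  have hpi1 := Real.pi_gt_d4
  have hpi2 := Real.pi_lt_d4
  have hy0 : (3199 : ℝ) / 10000 ≤ y := by rw [hydef]; linarith
  have hy1 : y ≤ (32 : ℝ) / 100 := by rw [hydef]; linarith
  have hy3 : y ^ 3 ≤ ((32 : ℝ) / 100) ^ 3 := pow_le_pow_left₀ (by linarith) hy1 3
  have hL : (3139 : ℝ) / 10000 ≤ y - y ^ 3 / 6 := by nlinarith
  have hsin : (3139 : ℝ) / 10000 ≤ Real.sin y := hL.trans (Real.sin_ge_sub_cube (by linarith))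
  have hpyth := Real.sin_sq_add_cos_sq y
  nlinarith [mul_le_mul hsin hsin (by norm_num) ((show (0:ℝ) ≤ 3139 / 10000 by norm_num).trans hsin)]

/-- `0 < sin (11π/54)` (the angle lies in `(0, π)`). -/
theorem sin_omega_eleven_pos : 0 < Real.sin (11 * Real.pi / 54) :=
  Real.sin_pos_of_pos_of_lt_pi (by positivity) (by nlinarith [Real.pi_pos])

/-- `0 ≤ cos (11π/54)` (the angle lies in `[0, π/2]`). -/
theorem cos_omega_eleven_nonneg : 0 ≤ Real.cos (11 * Real.pi / 54) :=
  Real.cos_nonneg_of_neg_pi_div_two_le_of_le (by nlinarith [Real.pi_pos]) (by nlinarith [Real.pi_pos])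

/-! ### §44.2 Re-indexing a cover by `≤ n` caps as a cover by an `n`-family of caps -/

/-- A cover of a set by the caps about `f z`, `z ∈ Z'` (`Z'` nonempty, `card Z' ≤ n`) is a cover by an
`n`-indexed family of the same caps (repetitions allowed) — the form in which the Fejes Tóth fact is typed. -/
theorem cover_family_of_finset {n : ℕ} {Z' : Finset (EuclideanSpace ℝ (Fin 3))} (hcard : Z'.card ≤ n)
    (hne : Z'.Nonempty) (f : EuclideanSpace ℝ (Fin 3) → EuclideanSpace ℝ (Fin 3)) (θ : ℝ) :
    ∃ a : Fin n → EuclideanSpace ℝ (Fin 3), (∀ i, ∃ z ∈ Z', a i = f z) ∧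
      (⋃ z ∈ Z', sphCap (f z) θ) ⊆ ⋃ i, sphCap (a i) θ := by
  obtain ⟨z₀, hz₀⟩ := hne
  let e := Z'.equivFin
  let a : Fin n → EuclideanSpace ℝ (Fin 3) := fun i =>
    if h : (i : ℕ) < Z'.card then f ((e.symm ⟨i, h⟩ : Z') : EuclideanSpace ℝ (Fin 3)) else f z₀
  refine ⟨a, fun i => ?_, fun x hx => ?_⟩
  · by_cases h : (i : ℕ) < Z'.card
    · exact ⟨(e.symm ⟨i, h⟩ : Z'), (e.symm ⟨i, h⟩).2, dif_pos h⟩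
    · exact ⟨z₀, hz₀, dif_neg h⟩
  · obtain ⟨z, hz, hxz⟩ := mem_iUnion₂.1 hx
    set j : Fin Z'.card := e ⟨z, hz⟩ with hj
    have hi : ((Fin.castLE hcard j : Fin n) : ℕ) < Z'.card := by simp [j.isLt]
    refine mem_iUnion.2 ⟨Fin.castLE hcard j, ?_⟩
    have hai : a (Fin.castLE hcard j) = f z := by
      show (if h : ((Fin.castLE hcard j : Fin n) : ℕ) < Z'.card then
          f ((e.symm ⟨(Fin.castLE hcard j : ℕ), h⟩ : Z') : EuclideanSpace ℝ (Fin 3)) else f z₀) = f z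
      rw [dif_pos hi]
      have : (⟨((Fin.castLE hcard j : Fin n) : ℕ), hi⟩ : Fin Z'.card) = j := Fin.ext (by simp)
      rw [this, hj, Equiv.symm_apply_apply]
    rw [hai]
    exact hxz

/-! ### §44.3 ★ `FejesToth1943_sphereCovering → BallCoveringBound 11 (8/5)` -/

/-- **THE COVERING RUNG.**  Under L. Fejes Tóth's sphere-covering theorem, eleven points never come within `< 1`
of every point of a sphere of radius `8/5`: otherwise the eleven caps of angular radius `arccos (√39/8)`
(`= 38.68°`) about their directions cover `S²`, whereas any cover by `11` congruent caps needs radius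
`≥ arccos (cot (11π/54)/√3)` (`= 39.15°`); numerically `3 · (39/64) · sin² ω₁₁ ≤ cos² ω₁₁` forces
`cos² ω₁₁ ≥ 117/181 = 0.6464`, against `cos ω₁₁ ≤ 0.803`. -/
theorem ballCoveringBound_eight_fifths_of_sphereCovering (hFT : FejesToth1943_sphereCovering) :
    BallCoveringBound 11 (8 / 5) := by
  intro c Z hZ
  by_contra hcon
  push Not at hcon
  have hρ : (1 : ℝ) ≤ 8 / 5 := by norm_num
  have hρ0 : (0 : ℝ) < 8 / 5 := by norm_num
  set t : ℝ := Real.sqrt ((8 / 5 : ℝ) ^ 2 - 1) / (8 / 5) with ht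
  have hs39 : Real.sqrt ((8 / 5 : ℝ) ^ 2 - 1) ^ 2 = 39 / 25 := by
    rw [Real.sq_sqrt (by norm_num)]; norm_num
  have ht2 : t ^ 2 = 39 / 64 := by rw [ht, div_pow, hs39]; norm_num
  have ht0 : 0 ≤ t := div_nonneg (Real.sqrt_nonneg _) hρ0.le
  have ht1 : t ≤ 1 := by nlinarith
  have hcos : Real.cos (Real.arccos t) = t := Real.cos_arccos (by linarith) ht1
  -- the blocking points off the centre, and the cover of `S²` by the caps about their directions
  set Z' : Finset (EuclideanSpace ℝ (Fin 3)) := Z.filter (fun z => z ≠ c) with hZ'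
  let f : EuclideanSpace ℝ (Fin 3) → EuclideanSpace ℝ (Fin 3) := fun z => ‖z - c‖⁻¹ • (z - c)
  have hcover : {x : EuclideanSpace ℝ (Fin 3) | ‖x‖ = 1} ⊆ ⋃ z ∈ Z', sphCap (f z) (Real.arccos t) := by
    intro u hu
    have hu' : ‖u‖ = 1 := hu
    obtain ⟨z, hz, hd⟩ := hcon (c + (8 / 5 : ℝ) • u) (by
      rw [dist_eq_norm, add_sub_cancel_left, norm_smul, Real.norm_eq_abs, abs_of_pos hρ0, hu', mul_one])
    obtain ⟨hw0, hang⟩ := angle_le_arccos_of_dist_lt_one hρ hu' hd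
    have hzc : z ≠ c := fun hzc => hw0 (by rw [hzc, sub_self])
    refine mem_iUnion₂.2 ⟨z, Finset.mem_filter.2 ⟨hz, hzc⟩, hu', ?_⟩
    show InnerProductGeometry.angle (‖z - c‖⁻¹ • (z - c)) u ≤ Real.arccos t
    rw [InnerProductGeometry.angle_smul_left_of_pos _ _ (inv_pos.2 (norm_pos_iff.2 hw0))]
    exact hang
  -- `Z'` is nonempty: the point `c + (8/5) e₀` of the sphere is blocked by somebody
  have hne : Z'.Nonempty := by
    set u₀ : EuclideanSpace ℝ (Fin 3) := EuclideanSpace.single (0 : Fin 3) (1 : ℝ) with hu₀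
    have hu₀n : ‖u₀‖ = 1 := by simp [hu₀]
    obtain ⟨z, hz, hd⟩ := hcon (c + (8 / 5 : ℝ) • u₀) (by
      rw [dist_eq_norm, add_sub_cancel_left, norm_smul, Real.norm_eq_abs, abs_of_pos hρ0, hu₀n, mul_one])
    obtain ⟨hw0, -⟩ := angle_le_arccos_of_dist_lt_one hρ hu₀n hd
    exact ⟨z, Finset.mem_filter.2 ⟨hz, fun hzc => hw0 (by rw [hzc, sub_self])⟩⟩
  have hcard : Z'.card ≤ 11 := (Finset.card_filter_le _ _).trans hZ
  obtain ⟨a, ha, hsub⟩ := cover_family_of_finset hcard hne f (Real.arccos t)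
  have ha1 : ∀ i, ‖a i‖ = 1 := by
    intro i
    obtain ⟨z, hz, hai⟩ := ha i
    have hw0 : z - c ≠ 0 := sub_ne_zero.2 (Finset.mem_filter.1 hz).2
    rw [hai]
    show ‖‖z - c‖⁻¹ • (z - c)‖ = 1
    rw [norm_smul, norm_inv, norm_norm, inv_mul_cancel₀ (norm_ne_zero_iff.2 hw0)]
  -- Fejes Tóth: `cos (arccos t) = t ≤ cot ω₁₁ / √3`
  have hFT' := FejesToth1943_sphereCovering.cos_le hFT (n := 11) (by norm_num) (Real.arccos_nonneg t)
    (Real.arccos_le_pi t) ha1 (hcover.trans hsub)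
  rw [hcos] at hFT'
  have hω : ((11 : ℕ) : ℝ) * Real.pi / (6 * (((11 : ℕ) : ℝ) - 2)) = 11 * Real.pi / 54 := by
    push_cast; ring
  rw [hω, Real.cot_eq_cos_div_sin] at hFT'
  set co := Real.cos (11 * Real.pi / 54) with hco
  set si := Real.sin (11 * Real.pi / 54) with hsi
  have hsi0 : 0 < si := sin_omega_eleven_pos
  have hco0 : 0 ≤ co := cos_omega_eleven_nonneg
  have hco1 : co ≤ 803 / 1000 := cos_omega_eleven_le
  have hpyth : si ^ 2 + co ^ 2 = 1 := Real.sin_sq_add_cos_sq _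
  have h3 : (0 : ℝ) < Real.sqrt 3 := Real.sqrt_pos.2 (by norm_num)
  have hs3 : Real.sqrt 3 ^ 2 = 3 := Real.sq_sqrt (by norm_num)
  -- `t · √3 · sin ω ≤ cos ω`
  have h1 : t * Real.sqrt 3 * si ≤ co := by
    have := (le_div_iff₀ h3).1 hFT'
    exact (le_div_iff₀ hsi0).1 this
  have h2 : (t * Real.sqrt 3 * si) ^ 2 ≤ co ^ 2 := pow_le_pow_left₀ (by positivity) h1 2
  have h2' : t ^ 2 * 3 * si ^ 2 ≤ co ^ 2 := by
    calc t ^ 2 * 3 * si ^ 2 = (t * Real.sqrt 3 * si) ^ 2 := by rw [mul_pow, mul_pow, hs3]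
      _ ≤ co ^ 2 := h2
  rw [ht2] at h2'
  nlinarith [mul_le_mul hco1 hco1 hco0 (by norm_num : (0 : ℝ) ≤ 803 / 1000)]

/-- `BallCoveringBound 11 ρ` for every `ρ ≥ 8/5`, under the fact (radius monotonicity). -/
theorem ballCoveringBound_of_sphereCovering (hFT : FejesToth1943_sphereCovering) {ρ : ℝ} (hρ : 8 / 5 ≤ ρ) :
    BallCoveringBound 11 ρ :=
  ballCoveringBound_mono (by norm_num) hρ (ballCoveringBound_eight_fifths_of_sphereCovering hFT)

/-! ### §44.4 The rung: `NoLooseChunksF (11/4)` modulo the ONE cited fact -/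

/-- **★ `NoLooseChunksF (11/4)` modulo L. Fejes Tóth's sphere-covering theorem** (g32's
`noLooseChunksF_2p75_of_fejesToth` with its hypothesis `BallCoveringBound 11 (8/5)` DERIVED from the cited fact):
the proved-modulo-Literature top of the floor-`7/10` ladder drops `59/20 → 11/4`. -/
theorem noLooseChunksF_2p75_of_sphereCovering (hFT : FejesToth1943_sphereCovering) : NoLooseChunksF (11 / 4) :=
  noLooseChunksF_2p75_of_fejesToth (ballCoveringBound_eight_fifths_of_sphereCovering hFT)

/-- The band `[11/4, δ₂)` of the floor-`7/10` ladder is excluded for every `δ₂`, modulo the fact. -/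
theorem bandExclusionF_2p75_of_sphereCovering (hFT : FejesToth1943_sphereCovering) (δ₂ : ℝ) :
    BandExclusionF (11 / 4) δ₂ :=
  bandExclusionF_of_noLooseChunksF (noLooseChunksF_2p75_of_sphereCovering hFT)

/-- Modulo the fact, the remaining top piece of the ladder is `BandExclusionF 2 (11/4)`:
`NoLooseChunksF 2 ↔ BandExclusionF 2 (11/4)`. -/
theorem noLooseChunksF_two_iff_band_of_sphereCovering (hFT : FejesToth1943_sphereCovering) :
    NoLooseChunksF 2 ↔ BandExclusionF 2 (11 / 4) := by
  rw [noLooseChunksF_iff_band (show (2 : ℝ) ≤ 11 / 4 by norm_num)]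
  exact ⟨fun h => h.2, fun h => ⟨noLooseChunksF_2p75_of_sphereCovering hFT, h⟩⟩

end Summit.AtomisticToContinuum.Crystallization.Theorems.ContactSaturationLadderCoveringRung

end
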